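import Literature.AnabelianGeometry.EtaleTheta.Thm56SubdagCodomains
import Literature.AnabelianGeometry.EtaleTheta.Thm56SubdagProofs
import Literature.AnabelianGeometry.EtaleTheta.Thm56SubdagReach

/-!
# [EtTh] Prop. 5.5, varying-codomain form — derivations (PDF p.102 = printed p.328)

Mochizuki, *The étale theta function …*, Publ. RIMS **45** (2009)
[cite: MochizukiEtTh2009, Prop 5.5 proof p.328 (PDF p.102)].  abc-iut cell, layer L2, K4 sequel (seat abc-iut-w5-d020 gen 2);
PROOF-ONLY companion of `Thm56SubdagCodomains.lean`, re-running the derivations of `Thm56SubdagProofs.lean` /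
`Thm56SubdagReach.lean` with the transport source VARYING over an admissible class `IsCod` of `l·N`-codomains
(abc-iut-L2-lead ruling F-w5d123-3; print p.328 l.2–11 «linear morphisms `S″ → S`, `S″ → S‴`»):
* `rigidityFamilyCod_unique_of` — UNIQUENESS of a functorial family Kummer-determined at every codomain, from the bare
  reachability (abc-iut-w5-d123's `ReachableFromCodomains`, restated as the hypothesis `hreach` of the same shape:
  Δ-push onto, μ-pull injective suffice) — «precisely because of the original "functoriality" of the isomorphism for `S″`»;
* `bijectivelyReachableFromCodomains_of` — «which induce isomorphisms»: onto/injective ⇒ bijective under Def. 5.4 (a)(b)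
  at both ends (`card_muTorsion_eq`), provided codomains are theta-saturated (`hcodSat`);
* `rigidityFamilyCod_exists_of` — EXISTENCE: `ρ_S := μ-pull(φ)⁻¹ ∘ ν_{S″} ∘ Δ-push(φ)⁻¹` for a chosen reach `φ : S″ → S`,
  Kummer-determined at every codomain and functorial, from bijective reachability + `TransportIndependentCod ν` + the
  transport laws (P55-L06b);
* `cyclotomicRigidityCod_of` — Prop. 5.5 in this currency (`CyclotomicRigidityCod`).
HONEST FRAMING: kernel-checked implications between typed statements about the §5 data; nothing of [EtTh] is asserted
unconditionally; typed ≠ discharged; no side taken on [IUTchIII] Cor. 3.12.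
-/

noncomputable section

namespace Literature.AnabelianGeometry.EtaleTheta

open CategoryTheory
open FrobenioidCyclotomicRigidity

universe w v v' u u'

namespace ThetaFrobenioid

namespace Thm56Sub

variable {C : Type u} [Category.{v} C] {D : Type u'} [Category.{v'} D] {𝔉 : ThetaFrobenioid.{w} C D}
  {IsCod : C → Prop}

/-- **Uniqueness, varying codomains** (p.328 l.8–11): two families functorial for linear morphisms that agree at every
admissible codomain agree on every theta-saturated object reachable from some codomain by a linear morphism with Δ-push onto
and μ-pull injective (abc-iut-w5-d123's `ReachableFromCodomains`, hypothesis `hreach` of that shape).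
[cite: MochizukiEtTh2009, Prop 5.5 proof p.328 (PDF p.102)] -/
theorem rigidityFamilyCod_unique_of (hcodSat : ∀ S'', IsCod S'' → 𝔉.IsThetaSaturated S'')
    (hreach : ∀ S : C, 𝔉.IsThetaSaturated S → ∃ (S'' : C) (_ : IsCod S'') (φ : S'' ⟶ S), 𝔉.IsLinear φ ∧
      Function.Surjective (𝔉.lDeltaModNMap φ) ∧ Function.Injective (𝔉.muTorsionPull φ 𝔉.N))
    (ν : NativeIsoFamily 𝔉 IsCod) {ρ ρ' : RigidityFamily 𝔉}
    (hK : IsKummerDeterminedCod 𝔉 hcodSat ν ρ) (hρ : IsFunctorialLinear 𝔉 ρ)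
    (hK' : IsKummerDeterminedCod 𝔉 hcodSat ν ρ') (hρ' : IsFunctorialLinear 𝔉 ρ') : ρ = ρ' := by
  funext S hS
  obtain ⟨S'', hc, φ, hlin, hsurj, hinj⟩ := hreach S hS
  apply MulEquiv.ext
  intro y
  obtain ⟨x, rfl⟩ := hsurj y
  apply hinj
  rw [hρ φ hlin (hcodSat S'' hc) hS x, hρ' φ hlin (hcodSat S'' hc) hS x, hK S'' hc x, hK' S'' hc x]

/-- **«which induce isomorphisms», varying codomains** (p.328 l.2–8): reachability with Δ-push onto and μ-pull injective
implies BIJECTIVE reachability, since both `(l·Δ_Θ) ⊗ ℤ/Nℤ` have `N` elements (Def. 5.4 (b)) and both `μ_N` have `N`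
elements (Def. 5.4 (a), `card_muTorsion_eq`) — codomains being theta-saturated (`hcodSat`).
[cite: MochizukiEtTh2009, Prop 5.5 proof p.328 (PDF p.102)] -/
theorem bijectivelyReachableFromCodomains_of (hcodSat : ∀ S'', IsCod S'' → 𝔉.IsThetaSaturated S'')
    (hreach : ∀ S : C, 𝔉.IsThetaSaturated S → ∃ (S'' : C) (_ : IsCod S'') (φ : S'' ⟶ S), 𝔉.IsLinear φ ∧
      Function.Surjective (𝔉.lDeltaModNMap φ) ∧ Function.Injective (𝔉.muTorsionPull φ 𝔉.N)) :
    BijectivelyReachableFromCodomains 𝔉 IsCod := by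
  have hl : 0 < 𝔉.l := 𝔉.odd_l.pos
  intro S hS
  obtain ⟨S'', hc, φ, hφ, hsurj, hinj⟩ := hreach S hS
  have hS'' := hcodSat S'' hc
  refine ⟨S'', hc, φ, hφ, ?_, ?_⟩
  · haveI : Finite (𝔉.lDeltaModN S'') :=
      Nat.finite_of_card_ne_zero (by rw [hS''.card_lDeltaModN]; exact 𝔉.N.ne_zero)
    exact hsurj.bijective_of_nat_card_le (by rw [hS''.card_lDeltaModN, hS.card_lDeltaModN])
  · haveI : Finite (𝔉.muTorsion S'' 𝔉.N) :=
      Nat.finite_of_card_ne_zero (by rw [card_muTorsion_eq 𝔉 hl hS''.muSaturated]; exact 𝔉.N.ne_zero)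
    exact hinj.bijective_of_nat_card_le
      (by rw [card_muTorsion_eq 𝔉 hl hS''.muSaturated, card_muTorsion_eq 𝔉 hl hS.muSaturated])

/-- **Existence, varying codomains** (p.327 l.−6 – p.328 l.11): from native isomorphisms `ν_{S″}` at every codomain,
bijective reachability, the independence of the transport (`TransportIndependentCod ν`) and the transport laws, there is a
rigidity family Kummer-determined at every codomain and functorial for linear morphisms:
`ρ_S := μ-pull(φ_S)⁻¹ ∘ ν_{S″_S} ∘ Δ-push(φ_S)⁻¹`.  [cite: MochizukiEtTh2009, Prop 5.5 proof p.328 (PDF p.102)] -/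
theorem rigidityFamilyCod_exists_of (hcodSat : ∀ S'', IsCod S'' → 𝔉.IsThetaSaturated S'')
    (ν : NativeIsoFamily 𝔉 IsCod) (hreach : BijectivelyReachableFromCodomains 𝔉 IsCod)
    (hind : TransportIndependentCod 𝔉 ν)
    (hUc : UnitsPullComp 𝔉) (hUi : UnitsPullId 𝔉) (hLc : LDeltaMapComp 𝔉) (hLi : LDeltaMapId 𝔉) :
    ∃ ρ : RigidityFamily 𝔉, IsKummerDeterminedCod 𝔉 hcodSat ν ρ ∧ IsFunctorialLinear 𝔉 ρ := by
  classical
  choose src hc φ hlin hΔ hμ using hreach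
  let EΔ : ∀ S (hS : 𝔉.IsThetaSaturated S), 𝔉.lDeltaModN (src S hS) ≃* 𝔉.lDeltaModN S := fun S hS =>
    MulEquiv.ofBijective (𝔉.lDeltaModNMap (φ S hS)) (hΔ S hS)
  let Eμ : ∀ S (hS : 𝔉.IsThetaSaturated S), 𝔉.muTorsion S 𝔉.N ≃* 𝔉.muTorsion (src S hS) 𝔉.N := fun S hS =>
    MulEquiv.ofBijective (𝔉.muTorsionPull (φ S hS) 𝔉.N) (hμ S hS)
  let ρ : RigidityFamily 𝔉 := fun S hS => ((EΔ S hS).symm.trans (ν (src S hS) (hc S hS))).trans (Eμ S hS).symm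
  have hchar : ∀ S (hS : 𝔉.IsThetaSaturated S) (y : 𝔉.lDeltaModN S),
      𝔉.muTorsionPull (φ S hS) 𝔉.N (ρ S hS y) = ν (src S hS) (hc S hS) ((EΔ S hS).symm y) := by
    intro S hS y
    change (Eμ S hS) ((Eμ S hS).symm (ν (src S hS) (hc S hS) ((EΔ S hS).symm y))) = _
    rw [MulEquiv.apply_symm_apply]
  have hEΔ : ∀ S (hS : 𝔉.IsThetaSaturated S) (y : 𝔉.lDeltaModN S),
      𝔉.lDeltaModNMap (φ S hS) ((EΔ S hS).symm y) = y := fun S hS y => (EΔ S hS).apply_symm_apply y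
  refine ⟨ρ, ?_, ?_⟩
  · -- Kummer-determined at a codomain `S₀`: compare the chosen reach with `(S₀, 𝟙)`
    intro S₀ hc₀ x
    have key := hind S₀ (hcodSat S₀ hc₀) (src S₀ (hcodSat S₀ hc₀)) S₀ (hc S₀ _) hc₀ (φ S₀ _) (𝟙 S₀)
      (hlin S₀ _) (𝔉.pre.degFr_id S₀) ((EΔ S₀ _).symm x) x (ρ S₀ (hcodSat S₀ hc₀) x)
      (by rw [hEΔ, lDeltaModNMap_id hLi]) (hchar S₀ _ x)
    rw [muTorsionPull_id hUi] at key
    exact key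
  · -- functoriality along a linear `ψ : S → T`: compare the reaches `(src T, φ_T)` and `(src S, φ_S ≫ ψ)` into `T`
    intro S T ψ hψ hS hT x
    set x₁ := (EΔ S hS).symm x with hx₁
    have hx : 𝔉.lDeltaModNMap (φ S hS) x₁ = x := hEΔ S hS x
    have key := hind T hT (src T hT) (src S hS) (hc T hT) (hc S hS) (φ T hT) (φ S hS ≫ ψ) (hlin T hT)
      (isLinear_comp (hlin S hS) hψ) ((EΔ T hT).symm (𝔉.lDeltaModNMap ψ x)) x₁ (ρ T hT (𝔉.lDeltaModNMap ψ x))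
      (by rw [hEΔ, lDeltaModNMap_comp hLc, hx]) (hchar T hT _)
    rw [muTorsionPull_comp hUc] at key
    apply (hμ S hS).1
    rw [key, hchar S hS x]

/-- **[EtTh] Proposition 5.5, varying-codomain currency (`CyclotomicRigidityCod`), modulo its named inputs**: native isos at
every codomain (`ν`, the Prop. 5.2 (iii)/Prop. 1.3 content at each `l·N`-codomain), reachability from codomains with Δ-push
onto / μ-pull injective (abc-iut-w5-d123's `ReachableFromCodomains` shape, `hreach`), codomains theta-saturated (`hcodSat`),
the independence `TransportIndependentCod ν` and the transport laws.  [cite: MochizukiEtTh2009, Prop 5.5 p.327–328 (PDF pp.101–102)] -/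
theorem cyclotomicRigidityCod_of (hcodSat : ∀ S'', IsCod S'' → 𝔉.IsThetaSaturated S'')
    (ν : NativeIsoFamily 𝔉 IsCod)
    (hreach : ∀ S : C, 𝔉.IsThetaSaturated S → ∃ (S'' : C) (_ : IsCod S'') (φ : S'' ⟶ S), 𝔉.IsLinear φ ∧
      Function.Surjective (𝔉.lDeltaModNMap φ) ∧ Function.Injective (𝔉.muTorsionPull φ 𝔉.N))
    (hind : TransportIndependentCod 𝔉 ν)
    (hUc : UnitsPullComp 𝔉) (hUi : UnitsPullId 𝔉) (hLc : LDeltaMapComp 𝔉) (hLi : LDeltaMapId 𝔉) :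
    CyclotomicRigidityCod 𝔉 hcodSat ν :=
  ⟨rigidityFamilyCod_exists_of hcodSat ν (bijectivelyReachableFromCodomains_of hcodSat hreach) hind hUc hUi hLc hLi,
    fun _ _ hK hρ hK' hρ' => rigidityFamilyCod_unique_of hcodSat hreach ν hK hρ hK' hρ'⟩

end Thm56Sub

end ThetaFrobenioid

end Literature.AnabelianGeometry.EtaleTheta
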